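/-
Copyright (c) 2026. All rights reserved.
Released under Apache 2.0 license as described in the file LICENSE.
Authors: abc-iut cell, prover seat abc-iut-E-t32 (gen 11).
-/
import Literature.IUT.LogVolume.DifferentLocalCriterion
import Literature.IUT.LogVolume.DifferentEstimatesCorollaries
import Literature.IUT.LogVolume.UnitLogWildQuadraticDyadicCases
import Literature.IUT.LogVolume.FundamentalIdentity
import HarnessLib

/-!
# Wild quadratic dyadic fields with a fixed ball have different `𝔪²`: `e = 2`, `f = 1`, `2^k·log₂(𝒪^×)` a ball `⇒ d = 1`

Classical local algebra (Serre, *Local Fields* III §6; Neukirch ANT II (5.5), III (2.6)); proof-only sequel of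
abc-iut-w4-d017's `UnitLogWildQuadraticDyadicCases.lean` and abc-iut-S1's `DifferentLocalCriterion.lean` /
`DifferentEstimatesCorollaries.lean`, for a complete ultrametric normed `ℚ₂`-algebra field `K` with `e = 2`, `f = 1`
(so `[K : ℚ₂] = 2`).  The exponent `δ` of the different `𝔇_{𝒪_K/ℤ₂} = 𝔪^δ` of such a field is `2` or `3`
(`1 ≤ d = δ/2 < 2`); this file decides it from the unit-log lattice:

* `exists_sq_eq_of_norm_eq_half_of_cube_dvd_different` — if `𝔪³ ∣ 𝔇` (`δ = 3`) then `K ∋ ρ` with `ρ² = a ∈ ℚ₂`,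
  `‖a‖ = 1/2` (the `ℚ₂(√±2)`, `ℚ₂(√±6)` shapes): for a uniformizer `ϖ` with minimal polynomial `X² + bX + c` the
  element `f'(ϖ) = 2ϖ + b` lies in `𝔇 ⊆ 𝔪³` (Mathlib `aeval_derivative_mem_differentIdeal`), forcing `‖b‖ ≤ 1/4`, and
  `ρ = ϖ + b/2`, `a = b²/4 − c`;
* **`differentOrd_eq_one_of_closedBall_eq_zpow_smul_logUnits`** — if SOME ball `{‖y‖ ≤ ‖t‖}` is a `2^k·log₂(𝒪_K^×)`
  then `d = differentOrd 2 K = 1` (`δ = 2`; the `ℚ₂(√3)` / `ℚ₂(√−1)` shapes), since the `‖a‖ = 1/2` shapes have NO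
  such ball (w4-d017 `closedBall_ne_zpow_smul_logUnits_of_norm_eq_half`);
* **`differentOrd_eq_one_of_logUnits_eq_closedBall_norm_two`** — in particular for `log₂(𝒪_K^×) = 2𝒪_K` (the
  `ℚ₂(√3)`-shape of the abc-iut cell's fixed-ball list, `Joshi/TestGenuinePinsDividingLine`).

Consumer: the Y-26 «discriminant degree cut» of the abc-iut cell (the `v ∣ 2` ramified places allowed by the pins
contribute exactly `2·log 2` each to `log |d_F|`).  Nothing here bears on the disputed [IUTchIII] Cor. 3.12.
-/

noncomputable section

open Metric Set IsLocalRing Polynomial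
open scoped NormedField Pointwise

namespace Literature.IUT.LogVolume

namespace WildQuadraticDyadic

open Literature.NumberTheory.GaloisRepresentations.Ultrametric

variable {K : Type*} [NontriviallyNormedField K] [NormedAlgebra ℚ_[2] K] [IsUltrametricDist K] [ProperSpace K]

/-! ## 1. `[K : ℚ₂] = 2`: a uniformizer generates, with a quadratic minimal polynomial -/

/-- `e = 2`, `f = 1` `⇒ [K : ℚ₂] = 2`. [cite: NeukirchANT1999, Ch. II Prop. (6.8)] -/
theorem finrank_eq_two (he : absRamificationIdx 2 K = 2) (hf : residueDegree 2 K = 1) :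
    Module.finrank ℚ_[2] K = 2 := by
  have h := absRamificationIdx_mul_residueDegree 2 K
  rw [he, hf] at h
  omega

/-- A uniformizer of a field with `e = 2` is not in `ℚ₂` (its norm `2^{-1/2}` is not a `2`-adic absolute value).
[cite: NeukirchANT1999, Ch. II Prop. (5.5)] -/
theorem unif_not_mem_range (he : absRamificationIdx 2 K = 2) {ϖ : Kˣ} (hϖ : IsUniformizer ϖ) :
    (ϖ : K) ∉ (algebraMap ℚ_[2] K).range := by
  rintro ⟨a, ha⟩
  have hsq := norm_unif_sq hϖ he
  rw [← ha, norm_algebraMap'] at hsq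
  have ha0 : a ≠ 0 := by
    rintro rfl
    simp at hsq
  rw [Padic.norm_eq_zpow_neg_valuation ha0, ← zpow_natCast, ← zpow_mul, show (2⁻¹ : ℝ) = (2 : ℝ) ^ (-1 : ℤ) by
    norm_num] at hsq
  have hinj := zpow_right_injective₀ (by norm_num : (0 : ℝ) < 2) (by norm_num : (2 : ℝ) ≠ 1) hsq
  omega

variable (he : absRamificationIdx 2 K = 2) (hf : residueDegree 2 K = 1) {ϖ : Kˣ} (hϖ : IsUniformizer ϖ)
include he hf hϖ

/-- The minimal polynomial of a uniformizer over `ℚ₂` has degree `2`. [cite: NeukirchANT1999, Ch. II Prop. (6.8)] -/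
theorem natDegree_minpoly_unif : (minpoly ℚ_[2] (ϖ : K)).natDegree = 2 := by
  haveI := finiteDimensional 2 K
  have hint : IsIntegral ℚ_[2] (ϖ : K) := Algebra.IsIntegral.isIntegral _
  have hle : (minpoly ℚ_[2] (ϖ : K)).natDegree ≤ 2 := (minpoly.natDegree_le (ϖ : K)).trans (finrank_eq_two he hf).le
  have hne1 : (minpoly ℚ_[2] (ϖ : K)).natDegree ≠ 1 := fun h1 =>
    unif_not_mem_range he hϖ (minpoly.natDegree_eq_one_iff.mp h1)
  have hpos : 0 < (minpoly ℚ_[2] (ϖ : K)).natDegree := minpoly.natDegree_pos hint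
  omega

/-- `ℚ₂(ϖ) = K`. [cite: NeukirchANT1999, Ch. II Prop. (6.8)] -/
theorem adjoin_unif_eq_top : IntermediateField.adjoin ℚ_[2] ({(ϖ : K)} : Set K) = ⊤ := by
  haveI := finiteDimensional 2 K
  have hint : IsIntegral ℚ_[2] (ϖ : K) := Algebra.IsIntegral.isIntegral _
  refine IntermediateField.eq_of_le_of_finrank_eq le_top ?_
  rw [IntermediateField.adjoin.finrank hint, natDegree_minpoly_unif he hf hϖ, IntermediateField.finrank_top',
    finrank_eq_two he hf]

/-- The quadratic relation `ϖ² + bϖ + c = 0`, `b, c` the coefficients of the minimal polynomial `X² + bX + c`.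
[cite: NeukirchANT1999, Ch. II Prop. (6.8)] -/
theorem minpoly_unif_eq :
    minpoly ℚ_[2] (ϖ : K) = X ^ 2 + C ((minpoly ℚ_[2] (ϖ : K)).coeff 1) * X + C ((minpoly ℚ_[2] (ϖ : K)).coeff 0) := by
  haveI := finiteDimensional 2 K
  have hint : IsIntegral ℚ_[2] (ϖ : K) := Algebra.IsIntegral.isIntegral _
  have hmon := minpoly.monic hint
  have h2 := natDegree_minpoly_unif he hf hϖ
  conv_lhs => rw [hmon.as_sum, h2]
  simp [Finset.sum_range_succ]
  ring

/-- `ϖ² + b·ϖ + c = 0` in `K`. [cite: NeukirchANT1999, Ch. II Prop. (6.8)] -/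
theorem unif_sq_add :
    (ϖ : K) ^ 2 + algebraMap ℚ_[2] K ((minpoly ℚ_[2] (ϖ : K)).coeff 1) * ϖ +
      algebraMap ℚ_[2] K ((minpoly ℚ_[2] (ϖ : K)).coeff 0) = 0 := by
  have h := minpoly.aeval ℚ_[2] (ϖ : K)
  rw [minpoly_unif_eq he hf hϖ] at h
  simpa [Polynomial.aeval_C] using h

/-! ## 2. `𝔪³ ∣ 𝔇 ⇒ ‖b‖ ≤ 1/4` (the derivative `2ϖ + b` of the minimal polynomial lies in the different) -/

/-- `f'(ϖ) = 2ϖ + b ∈ 𝔇 ⊆ 𝔪³` forces `‖2ϖ + b‖ ≤ 2^{-3/2}`. [cite: SerreLocalFields1979, Ch. III §6 Cor. 2] -/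
theorem norm_two_mul_unif_add_le_of_cube_dvd (h3 : maximalIdeal (Valued.integer K) ^ 3 ∣ different 2 K) :
    ‖2 * (ϖ : K) + algebraMap ℚ_[2] K ((minpoly ℚ_[2] (ϖ : K)).coeff 1)‖ ≤ (2 : ℝ) ^ (-((3 : ℝ) / 2)) := by
  haveI := finiteDimensional 2 K
  haveI := isFractionRing_integer 2 K
  haveI := isSeparable_fractionRing 2 K
  set x : Valued.integer K := ⟨(ϖ : K), hϖ.1.le⟩ with hxdef
  have hxK : ((x : Valued.integer K) : K) = (ϖ : K) := rfl
  have hint0 : IsIntegral ℚ_[2] (ϖ : K) := Algebra.IsIntegral.isIntegral _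
  have htop : Algebra.adjoin ℚ_[2] ({algebraMap (Valued.integer K) K x} : Set K) = ⊤ := by
    rw [show algebraMap (Valued.integer K) K x = (ϖ : K) from rfl,
      ← IntermediateField.adjoin_simple_toSubalgebra_of_isAlgebraic hint0.isAlgebraic, adjoin_unif_eq_top he hf hϖ,
      IntermediateField.top_toSubalgebra]
  have hmem := aeval_derivative_mem_differentIdeal ℤ_[2] ℚ_[2] K x htop
  -- `𝔇 ⊆ 𝔪³`
  have hle : different 2 K ≤ maximalIdeal (Valued.integer K) ^ 3 := Ideal.le_of_dvd h3
  have hmem3 : aeval x (derivative (minpoly ℤ_[2] x)) ∈ maximalIdeal (Valued.integer K) ^ 3 :=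
    hle (by rw [different_eq]; exact hmem)
  -- its value in `K`
  have hint : IsIntegral ℤ_[2] x := (isIntegral_integer 2 K).isIntegral x
  have hinj : Function.Injective (algebraMap (Valued.integer K) K) := Subtype.val_injective
  have hintK : IsIntegral ℤ_[2] (algebraMap (Valued.integer K) K x) := hint.algebraMap
  have hminZ : (minpoly ℤ_[2] x).map (algebraMap ℤ_[2] ℚ_[2]) = minpoly ℚ_[2] (ϖ : K) := by
    rw [← minpoly.algebraMap_eq hinj x, ← minpoly.isIntegrallyClosed_eq_field_fractions' ℚ_[2] hintK]
    rfl
  have hval : ((aeval x (derivative (minpoly ℤ_[2] x)) : Valued.integer K) : K) =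
      2 * (ϖ : K) + algebraMap ℚ_[2] K ((minpoly ℚ_[2] (ϖ : K)).coeff 1) := by
    have h1 : ((aeval x (derivative (minpoly ℤ_[2] x)) : Valued.integer K) : K) =
        aeval (ϖ : K) (derivative (minpoly ℤ_[2] x)) := by
      rw [← hxK]
      exact (Polynomial.aeval_algebraMap_apply K x _).symm
    rw [h1, ← Polynomial.aeval_map_algebraMap ℚ_[2], ← Polynomial.derivative_map, hminZ,
      minpoly_unif_eq he hf hϖ]
    simp
    ring
  -- elements of `𝔪³` have norm `≤ 2^{-3/2}`
  have hball : ((aeval x (derivative (minpoly ℤ_[2] x)) : Valued.integer K) : K) ∈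
      pBall 2 K ((3 : ℕ) / (absRamificationIdx 2 K : ℝ)) := by
    rw [← coe_maximalIdeal_pow_eq_pBall 2 K 3]
    exact ⟨_, hmem3, rfl⟩
  rw [mem_pBall_iff, hval, he] at hball
  simpa using hball

/-- `𝔪³ ∣ 𝔇 ⇒ ‖b‖ ≤ 1/4`. [cite: SerreLocalFields1979, Ch. III §6 Cor. 2] -/
theorem norm_coeff_one_le_quarter_of_cube_dvd (h3 : maximalIdeal (Valued.integer K) ^ 3 ∣ different 2 K) :
    ‖(minpoly ℚ_[2] (ϖ : K)).coeff 1‖ ≤ 4⁻¹ := by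
  set b := (minpoly ℚ_[2] (ϖ : K)).coeff 1 with hb
  have hsum := norm_two_mul_unif_add_le_of_cube_dvd he hf hϖ h3
  by_contra hlt
  -- `‖b‖ ≥ 1/2`
  have hhalf : 2⁻¹ ≤ ‖b‖ := by
    rw [not_le] at hlt
    have h := (Padic.norm_le_pow_iff_norm_lt_pow_add_one b (-2)).not
    rw [show ((2 : ℕ) : ℝ) ^ (-2 : ℤ) = 4⁻¹ by norm_num, show (-2 : ℤ) + 1 = -1 by norm_num,
      show ((2 : ℕ) : ℝ) ^ (-1 : ℤ) = 2⁻¹ by norm_num, not_le, not_lt] at h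
    exact h.mp hlt
  -- `‖2ϖ‖ = ‖ϖ‖/2 < 1/2 ≤ ‖b‖`, so `‖2ϖ + b‖ = ‖b‖ ≥ 1/2 > 2^{-3/2}`
  have h2ϖ : ‖2 * (ϖ : K)‖ < ‖algebraMap ℚ_[2] K b‖ := by
    rw [norm_mul, norm_algebraMap', show ‖(2 : K)‖ = 2⁻¹ by
      rw [← norm_unif_sq_eq_norm_two hϖ he]; exact norm_unif_sq hϖ he]
    calc (2⁻¹ : ℝ) * ‖(ϖ : K)‖ < 2⁻¹ * 1 := by gcongr; exact hϖ.1
      _ = 2⁻¹ := mul_one _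
      _ ≤ ‖b‖ := hhalf
  have heq : ‖2 * (ϖ : K) + algebraMap ℚ_[2] K b‖ = ‖algebraMap ℚ_[2] K b‖ :=
    IsUltrametricDist.norm_add_eq_max_of_norm_ne_norm h2ϖ.ne ▸ max_eq_right h2ϖ.le
  rw [heq, norm_algebraMap'] at hsum
  have hlt' : (2 : ℝ) ^ (-((3 : ℝ) / 2)) < 2⁻¹ := by
    rw [show (2⁻¹ : ℝ) = (2 : ℝ) ^ (-(1 : ℝ)) by rw [Real.rpow_neg_one]]
    exact Real.rpow_lt_rpow_of_exponent_lt (by norm_num) (by norm_num)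
  linarith

/-! ## 3. `𝔪³ ∣ 𝔇 ⇒ K = ℚ₂(ρ)`, `ρ² = a`, `‖a‖ = 1/2` -/

/-- **`δ = 3 ⇒` the `ℚ₂(√2u)`-shape**: if `𝔪³ ∣ 𝔇_{𝒪_K/ℤ₂}` then `K ∋ ρ` with `ρ² = a ∈ ℚ₂`, `‖a‖ = 1/2`
(`ρ = ϖ + b/2`, `a = b²/4 − c`). [cite: SerreLocalFields1979, Ch. III §6 Cor. 2] -/
theorem exists_sq_eq_of_norm_eq_half_of_cube_dvd_different
    (h3 : maximalIdeal (Valued.integer K) ^ 3 ∣ different 2 K) :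
    ∃ (ρ : K) (a : ℚ_[2]), ρ ^ 2 = algebraMap ℚ_[2] K a ∧ ‖a‖ = 2⁻¹ := by
  set b := (minpoly ℚ_[2] (ϖ : K)).coeff 1 with hb
  set c := (minpoly ℚ_[2] (ϖ : K)).coeff 0 with hc
  have hrel := unif_sq_add he hf hϖ
  have hb4 : ‖b‖ ≤ 4⁻¹ := norm_coeff_one_le_quarter_of_cube_dvd he hf hϖ h3
  refine ⟨(ϖ : K) + algebraMap ℚ_[2] K (b / 2), (b / 2) ^ 2 - c, ?_, ?_⟩
  · have h2 : algebraMap ℚ_[2] K b = 2 * algebraMap ℚ_[2] K (b / 2) := by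
      rw [← map_ofNat (algebraMap ℚ_[2] K) 2, ← map_mul, mul_div_cancel₀ b (two_ne_zero)]
    rw [h2] at hrel
    simp only [map_sub, map_pow]
    linear_combination hrel
  · -- `‖c‖ = 1/2`
    have hϖ2 : ‖(ϖ : K) ^ 2‖ = 2⁻¹ := by rw [norm_pow]; exact norm_unif_sq hϖ he
    have hbϖ : ‖algebraMap ℚ_[2] K b * ϖ‖ < ‖(ϖ : K) ^ 2‖ := by
      rw [hϖ2, norm_mul, norm_algebraMap']
      calc ‖b‖ * ‖(ϖ : K)‖ ≤ 4⁻¹ * 1 := by gcongr; exact hϖ.1.le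
        _ < 2⁻¹ := by norm_num
    have hc' : ‖c‖ = 2⁻¹ := by
      have : algebraMap ℚ_[2] K c = -((ϖ : K) ^ 2 + algebraMap ℚ_[2] K b * ϖ) := by linear_combination hrel
      rw [← norm_algebraMap' K c, this, norm_neg,
        IsUltrametricDist.norm_add_eq_max_of_norm_ne_norm hbϖ.ne', max_eq_left hbϖ.le, hϖ2]
    -- `‖(b/2)²‖ ≤ 1/4 < 1/2`
    have hb2 : ‖(b / 2) ^ 2‖ < ‖c‖ := by
      rw [hc', norm_pow, norm_div, show ‖(2 : ℚ_[2])‖ = 2⁻¹ from by exact_mod_cast (Padic.norm_p (p := 2))]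
      calc (‖b‖ / 2⁻¹) ^ 2 ≤ ((4⁻¹ : ℝ) / 2⁻¹) ^ 2 := by gcongr
        _ < 2⁻¹ := by norm_num
    rw [sub_eq_add_neg, IsUltrametricDist.norm_add_eq_max_of_norm_ne_norm (by rw [norm_neg]; exact hb2.ne),
      norm_neg, max_eq_right hb2.le, hc']

/-! ## 4. A fixed ball forces `d = 1` -/

omit hϖ in
/-- **A FIXED BALL FORCES `𝔇 = 𝔪²`**: if `e = 2`, `f = 1` and some ball `{‖y‖ ≤ ‖t‖}` is a `2^k·log₂(𝒪_K^×)` (the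
`ℚ₂(√3)` / `ℚ₂(√−1)` shapes of abc-iut-w4-d017's trichotomy), then `d = differentOrd 2 K = 1`, i.e. `δ = 2`: the
case `δ = 3` is the `‖a‖ = 1/2` shape, which has NO such ball (`closedBall_ne_zpow_smul_logUnits_of_norm_eq_half`).
[cite: SerreLocalFields1979, Ch. III §6 Prop. 13] [cite: NeukirchANT1999, Ch. II Prop. (5.5)] -/
theorem differentOrd_eq_one_of_closedBall_eq_zpow_smul_logUnits {t : K} {k : ℤ}
    (hball : closedBall (0 : K) ‖t‖ = ((2 : ℚ_[2]) ^ k) • logUnits K) : differentOrd 2 K = 1 := by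
  obtain ⟨ϖ, hϖ⟩ := exists_isUniformizer (F := K)
  -- `1 ≤ d` (wild) and `d = δ/2`
  have h1 : 1 ≤ differentOrd 2 K := one_le_differentOrd_of_dvd 2 K (by rw [he])
  obtain ⟨δ, -, hd⟩ := exists_different_eq_maximalIdeal_pow 2 K
  rw [he] at hd
  -- `¬ (3/2 ≤ d)`: otherwise `𝔪³ ∣ 𝔇` and `K` is of the `‖a‖ = 1/2` shape, which has no fixed ball
  have h3 : ¬ ((3 : ℕ) : ℝ) / (absRamificationIdx 2 K : ℝ) ≤ differentOrd 2 K := by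
    intro hle
    obtain ⟨ρ, a, hsq, ha⟩ := exists_sq_eq_of_norm_eq_half_of_cube_dvd_different he hf hϖ
      ((div_le_differentOrd_iff_pow_dvd 2 K 3).mp hle)
    exact closedBall_ne_zpow_smul_logUnits_of_norm_eq_half he hf hsq ha t k hball
  rw [he, not_le, hd] at h3
  rw [hd] at h1 ⊢
  have hδ2 : (2 : ℝ) ≤ δ := by
    have := (le_div_iff₀ (by norm_num : (0 : ℝ) < (2 : ℕ))).mp h1
    simpa using this
  have hδ3 : (δ : ℝ) < 3 := by
    have := (div_lt_div_iff_of_pos_right (by norm_num : (0 : ℝ) < (2 : ℕ))).mp h3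
    exact_mod_cast this
  have hδ : δ = 2 := by
    have h2' : 2 ≤ δ := by exact_mod_cast hδ2
    have h3' : δ < 3 := by exact_mod_cast hδ3
    omega
  subst hδ
  norm_num

omit hϖ in
/-- **The `ℚ₂(√3)`-shape has `d = 1`**: `e = 2`, `f = 1`, `log₂(𝒪_K^×) = {‖y‖ ≤ ‖2‖} = 2𝒪_K` `⇒ differentOrd 2 K = 1`
(so the place contributes `e·d·f·log 2 = 2·log 2` to `log |d_F|`). [cite: SerreLocalFields1979, Ch. III §6 Prop. 13]
[cite: NeukirchANT1999, Ch. II Prop. (5.5)] -/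
theorem differentOrd_eq_one_of_logUnits_eq_closedBall_norm_two
    (hlog : logUnits K = closedBall (0 : K) ‖(2 : K)‖) : differentOrd 2 K = 1 :=
  differentOrd_eq_one_of_closedBall_eq_zpow_smul_logUnits he hf (t := (2 : K)) (k := 0)
    (by rw [zpow_zero, one_smul, hlog])

end WildQuadraticDyadic

end Literature.IUT.LogVolume

end
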